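import Mathlib.RingTheory.MvPolynomial.WeightedHomogeneous
import Mathlib.RingTheory.MvPolynomial.Basic
import Mathlib.RingTheory.Ideal.Operations
import Mathlib.Algebra.BigOperators.Fin
import HarnessLib

/-!
# Veronese splitting for the weights `(6,3,9,2)` and `N = 18` (crux `FInjectiveMacaulayfication`, line `Sketch`)

Support file for crux stmt-ResolutionOfSingularities-15315 (`FrobeniusLadder.FInjectiveMacaulayfication`,
line `Sketch`), stub `stub_veroneseSplitting` of the cycle-9 WEIGHTED CONE ENGINE (§15 of the skeleton),
calibrated on the specimen `f₄ = X₂² + X₀³ + X₁⁶ + X₃³X₀²` with weights `w = (6,3,9,2)` on `X₀,…,X₃`.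

Let `I₁₈ ⊆ k[X₀,…,X₃]` be the ideal spanned by the monomials `X^b` of weighted degree
`Finsupp.weight w b = 6b₀ + 3b₁ + 9b₂ + 2b₃ ≥ 18`. **Veronese splitting**: every monomial of weighted
degree `≥ 18K` lies in `I₁₈ ^ K` (i.e. `I_{18K} ⊆ I₁₈^K`, the hypothesis under which the charts
`D₊(Xⱼ^{cⱼ} t)` cover the weighted blow-up `Bl_{I₁₈}`). This is FALSE for general weights (e.g.
`(14,6,21,2)`, `N = 42`, `X₀²X₁⁶X₂`), so it is a genuine arithmetic certificate of the specimen.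

Proof. Induction on `K`; the step is the exponent-vector statement `coord_split`: if
`(K+1)·18 ≤ w·a` then `a = b + c` with `18 ≤ w·b` and `K·18 ≤ w·c`. PEEL: if `a₀ ≥ 3` (resp.
`a₁ ≥ 6`, `a₂ ≥ 2`, `a₃ ≥ 9`) take for `b` the pure block `X₀³` (resp. `X₁⁶`, `X₂²`, `X₃⁹`) of degree
exactly `18`. Otherwise `a` lies in the box `a₀ ≤ 2, a₁ ≤ 5, a₂ ≤ 1, a₃ ≤ 8`, of degree `≤ 52 < 54`,
so `K ≤ 1`; `K = 0`: `b = a`; `K = 1` (degree `≥ 36`): explicit witnesses — for `a₀ ≤ 1`,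
`b = (a₀, 6 - 2a₀ - 3a₂, a₂, 0)` (degree exactly `18`); for `a₀ = 2`, `b = (2,2,0,0)` when `a₁ ≥ 2` and
`b = (0, a₁, a₂, 5 - 2a₁)` when `a₁ ≤ 1` — each verified by `omega`. The monomial identity
`X^(b+c) = X^b · X^c` (`MvPolynomial.monomial_mul`) and `Ideal.mul_mem_mul` finish (`I^(K+1) = I · I^K`).

All proofs are glue on Mathlib (`Finsupp.weight_apply`, `Finsupp.sum_fintype`, `Fin.sum_univ_four`,
`Finsupp.coe_equivFunOnFinite_symm`, `MvPolynomial.monomial_mul`, `Ideal.mul_mem_mul`,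
`Ideal.subset_span`); no definitions, no named facts. [folklore]
-/

-- single-problem summit: the doubled namespace component is forced
set_option linter.dupNamespace false

namespace Summit.ResolutionOfSingularities.ResolutionOfSingularities.Theorems.FInjectiveMacaulayfication.VeroneseSplitting

/-- **Coordinate splitting.** If `(K+1)·18 ≤ 6a₀ + 3a₁ + 9a₂ + 2a₃` then the exponent vector
`(a₀,a₁,a₂,a₃)` splits as `b + c` with `18 ≤ 6b₀+3b₁+9b₂+2b₃` and `K·18 ≤ 6c₀+3c₁+9c₂+2c₃`: peel a
pure block `X₀³, X₁⁶, X₂², X₃⁹` of weighted degree exactly `18` when an exponent is large; otherwise the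
vector lies in the box `a₀ ≤ 2, a₁ ≤ 5, a₂ ≤ 1, a₃ ≤ 8` (degree `≤ 52`, so `K ≤ 1`), where `K = 0` is
trivial and `K = 1` is settled by the explicit witnesses `b = (a₀, 6-2a₀-3a₂, a₂, 0)` (`a₀ ≤ 1`),
`b = (0, a₁, a₂, 5-2a₁)` (`a₀ = 2`, `a₁ ≤ 1`), `b = (2,2,0,0)` (`a₀ = 2`, `a₁ ≥ 2`), all checked by
`omega`. [folklore] -/
theorem coord_split (K a₀ a₁ a₂ a₃ : ℕ) (h : (K + 1) * 18 ≤ 6 * a₀ + 3 * a₁ + 9 * a₂ + 2 * a₃) :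
    ∃ b₀ b₁ b₂ b₃ c₀ c₁ c₂ c₃ : ℕ, a₀ = b₀ + c₀ ∧ a₁ = b₁ + c₁ ∧ a₂ = b₂ + c₂ ∧ a₃ = b₃ + c₃ ∧
      18 ≤ 6 * b₀ + 3 * b₁ + 9 * b₂ + 2 * b₃ ∧ K * 18 ≤ 6 * c₀ + 3 * c₁ + 9 * c₂ + 2 * c₃ := by
  by_cases h₀ : 3 ≤ a₀
  · exact ⟨3, 0, 0, 0, a₀ - 3, a₁, a₂, a₃, by omega⟩
  by_cases h₁ : 6 ≤ a₁
  · exact ⟨0, 6, 0, 0, a₀, a₁ - 6, a₂, a₃, by omega⟩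
  by_cases h₂ : 2 ≤ a₂
  · exact ⟨0, 0, 2, 0, a₀, a₁, a₂ - 2, a₃, by omega⟩
  by_cases h₃ : 9 ≤ a₃
  · exact ⟨0, 0, 0, 9, a₀, a₁, a₂, a₃ - 9, by omega⟩
  -- the box `a₀ ≤ 2, a₁ ≤ 5, a₂ ≤ 1, a₃ ≤ 8`: weighted degree `≤ 52`, hence `K ≤ 1`
  rcases Nat.eq_zero_or_pos K with rfl | hK
  · exact ⟨a₀, a₁, a₂, a₃, 0, 0, 0, 0, by omega⟩
  -- `K = 1`, degree `≥ 36`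
  by_cases h₀' : a₀ ≤ 1
  · exact ⟨a₀, 6 - 2 * a₀ - 3 * a₂, a₂, 0, 0, a₁ - (6 - 2 * a₀ - 3 * a₂), 0, a₃, by omega⟩
  by_cases h₁' : a₁ ≤ 1
  · exact ⟨0, a₁, a₂, 5 - 2 * a₁, 2, 0, 0, a₃ - (5 - 2 * a₁), by omega⟩
  · exact ⟨2, 2, 0, 0, 0, a₁ - 2, a₂, a₃, by omega⟩

/-- The `(6,3,9,2)`-weighted degree of an exponent vector `f : Fin 4 →₀ ℕ` in coordinates:
`Finsupp.weight ![6,3,9,2] f = 6 f₀ + 3 f₁ + 9 f₂ + 2 f₃` (`Finsupp.weight_apply`,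
`Finsupp.sum_fintype`, `Fin.sum_univ_four`). [folklore] -/
theorem weight_eq (f : Fin 4 →₀ ℕ) :
    Finsupp.weight (![6, 3, 9, 2] : Fin 4 → ℕ) f = 6 * f 0 + 3 * f 1 + 9 * f 2 + 2 * f 3 := by
  rw [Finsupp.weight_apply,
    Finsupp.sum_fintype f (fun i c => c • (![6, 3, 9, 2] : Fin 4 → ℕ) i) (fun _ => zero_smul ℕ _),
    Fin.sum_univ_four]
  simp only [smul_eq_mul, Matrix.cons_val_zero, Matrix.cons_val_one, Matrix.cons_val]
  ring

/-- **Exponent-vector splitting.** If `(K+1)·18 ≤ weight ![6,3,9,2] a` for `a : Fin 4 →₀ ℕ`, then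
`a = b + c` with `18 ≤ weight b` and `K·18 ≤ weight c` (`coord_split` transported along the four
coordinates via `Finsupp.equivFunOnFinite`). [folklore] -/
theorem finsupp_split (K : ℕ) (a : Fin 4 →₀ ℕ)
    (ha : (K + 1) * 18 ≤ Finsupp.weight (![6, 3, 9, 2] : Fin 4 → ℕ) a) :
    ∃ b c : Fin 4 →₀ ℕ, a = b + c ∧ 18 ≤ Finsupp.weight (![6, 3, 9, 2] : Fin 4 → ℕ) b ∧
      K * 18 ≤ Finsupp.weight (![6, 3, 9, 2] : Fin 4 → ℕ) c := by
  rw [weight_eq] at ha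
  obtain ⟨b₀, b₁, b₂, b₃, c₀, c₁, c₂, c₃, e₀, e₁, e₂, e₃, hb, hc⟩ :=
    coord_split K (a 0) (a 1) (a 2) (a 3) ha
  refine ⟨Finsupp.equivFunOnFinite.symm ![b₀, b₁, b₂, b₃],
    Finsupp.equivFunOnFinite.symm ![c₀, c₁, c₂, c₃], ?_, ?_, ?_⟩
  · ext i
    fin_cases i <;> simp [e₀, e₁, e₂, e₃]
  · rw [weight_eq]
    simpa using hb
  · rw [weight_eq]
    simpa using hc

/-- **VERONESE SPLITTING for the weights `(6,3,9,2)` and `N = 18`**: every monomial of weighted degree `≥ 18K`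
lies in the `K`-th power of the ideal `I₁₈` spanned by the monomials of weighted degree `≥ 18` (i.e.
`I_{18K} ⊆ I₁₈^K`; peel a pure block `X₀³, X₁⁶, X₂², X₃⁹` of degree exactly `18` when an exponent is large, and a
finite check on the box `a₀ ≤ 2, a₁ ≤ 5, a₂ ≤ 1, a₃ ≤ 8`, where only `K ≤ 2` occurs). FALSE for general weights
(e.g. `(14,6,21,2)`, `N = 42`, `X₀²X₁⁶X₂`), hence a hypothesis of the engine. Proof: induction on `K`
(`I^0 = ⊤`; `X^a = X^b · X^c` with `X^b ∈ I₁₈` a generator and `X^c ∈ I₁₈^K` by induction, via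
`finsupp_split`, `MvPolynomial.monomial_mul`, `Ideal.mul_mem_mul`). [folklore] -/
theorem stub_veroneseSplitting : ∀ (k : Type) [Field k] (K : ℕ) (a : Fin 4 →₀ ℕ),
    K * 18 ≤ Finsupp.weight (![6, 3, 9, 2] : Fin 4 → ℕ) a →
    (MvPolynomial.monomial a (1 : k) : MvPolynomial (Fin 4) k) ∈
      (Ideal.span {m : MvPolynomial (Fin 4) k | ∃ b : Fin 4 →₀ ℕ,
        18 ≤ Finsupp.weight (![6, 3, 9, 2] : Fin 4 → ℕ) b ∧ m = MvPolynomial.monomial b 1}) ^ K := by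
  intro k _ K
  induction K with
  | zero =>
    intro a _
    rw [pow_zero, Ideal.one_eq_top]
    exact Submodule.mem_top
  | succ K ih =>
    intro a ha
    obtain ⟨b, c, rfl, hb, hc⟩ := finsupp_split K a ha
    have hmul : (MvPolynomial.monomial (b + c) (1 : k) : MvPolynomial (Fin 4) k) =
        MvPolynomial.monomial b 1 * MvPolynomial.monomial c 1 := by
      rw [MvPolynomial.monomial_mul, one_mul]
    rw [pow_succ', hmul]
    exact Ideal.mul_mem_mul (Ideal.subset_span ⟨b, hb, rfl⟩) (ih c hc)

end Summit.ResolutionOfSingularities.ResolutionOfSingularities.Theorems.FInjectiveMacaulayfication.VeroneseSplitting
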